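import Summits.ResolutionOfSingularities.ResolutionOfSingularities.Theorems.FrobeniusLadderFRationalResolutionMonoidAlgebraLaurent
import Literature.AlgebraicGeometry.Resolution.AffineBlowupAlgebra
import HarnessLib

/-!
# Crux `FrobeniusLadder.FRationalResolution` (stmt-ResolutionOfSingularities-15317), line `redirect`,
# stub `stub_diagonalizableQuotientResolution` — THE CHART RING OF A MONOID ALGEBRA AT A MONOMIAL IS A MONOID ALGEBRA
# (step 2 of (β-chart), MEMO-15317-leafhand2-g25 §3): `κ[P][J/χ^{e₀}] = κ[Q]` inside `κ[P][1/χ^{e₀}]`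

For `P ⊆ ℕⁿ`, `E ⊆ P`, `e₀ ∈ P` (in the application `e₀ ∈ E`), `J = (χᵉ : e ∈ E)`, the affine blow-up algebra `C = κ[P][J/χ^{e₀}] ⊆ κ[P][1/χ^{e₀}]` is the monoid
algebra of the cone monoid `P + ℕ(E − e₀) ⊆ ℤⁿ`. Here the user supplies that monoid abstractly: `Q ⊆ ℕ^{n'}` with an injective
additive `ι : Q → ℤⁿ` whose image is `P + ℕ(E − e₀)` — spelled as three elementary hypotheses: (a) every `e − e₀` (`e ∈ E`) and
(b) every `p ∈ P` is an `ι q`, and (c) every `ι q` is `p + Σᵢ (eᵢ − e₀)` with `p ∈ P`, `eᵢ ∈ E`. Then there is an injective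
`κ`-algebra map `Φ : κ[Q] → κ[P][1/χ^{e₀}]` with image EXACTLY `C` and `Φ(χ^q)·(χ^{e₀})^k = χᵖ` whenever `ι q + k e₀ = p` — so
`C ≅ κ[Q]`, and the certificate slots of `…MonoidAlgebraModel` for `Q` transport to `C` (next step).

* ★★★ `exists_algHom_chart` — the statement above (through the Laurent embedding `Λ` of `…MonoidAlgebraLaurent`, p843534:
  `Φ(χ^q)` is THE element with `Λ(Φ χ^q) = x^{ι q}`; multiplicativity and injectivity from the injectivity of `Λ`).

Honest label: elementary toric algebra toward ONE leaf stub (no stub, crux or summit closed). No definitions, no named facts, no sorry.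
[folklore; cite: CoxLittleSchenck2011, §1.1 and (the blow-up charts of a toric variety) §3.3; Kollar2007, §2.2]
-/

noncomputable section

-- single-problem summit: the doubled namespace component is forced
set_option linter.dupNamespace false

open Literature.AlgebraicGeometry.Resolution

namespace Summit.ResolutionOfSingularities.ResolutionOfSingularities.Theorems.FRationalResolution.MonoidAlgebraLaurent

variable (κ : Type) [Field κ] {n : ℕ} (P : AddSubmonoid (Fin n →₀ ℕ))

/-- The exponent of `p ∈ ℕⁿ` in `ℤⁿ`. -/
local notation3 (prettyPrint := false) "toZ" =>
  (Finsupp.mapRange.addMonoidHom (Nat.castAddMonoidHom ℤ) : (Fin n →₀ ℕ) →+ (Fin n →₀ ℤ))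

/-- ★★★ **THE CHART RING OF `κ[P]` AT `χ^{e₀}` IS THE MONOID ALGEBRA OF THE CONE MONOID.** See the module docstring.
[folklore; cite: CoxLittleSchenck2011, §1.1, §3.3] -/
theorem exists_algHom_chart (e₀ : ↥P) (E : Set ↥P)
    {n' : ℕ} (Q : AddSubmonoid (Fin n' →₀ ℕ)) (ι : ↥Q →+ (Fin n →₀ ℤ)) (hι : Function.Injective ι)
    (hE : ∀ e ∈ E, ∃ q : ↥Q, ι q = toZ (e : Fin n →₀ ℕ) - toZ (e₀ : Fin n →₀ ℕ))
    (hP : ∀ p : ↥P, ∃ q : ↥Q, ι q = toZ (p : Fin n →₀ ℕ))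
    (hQ : ∀ q : ↥Q, ∃ (p : ↥P) (m : ℕ) (e : Fin m → ↥P), (∀ i, e i ∈ E) ∧
      ι q = toZ (p : Fin n →₀ ℕ) + ∑ i, (toZ ((e i : ↥P) : Fin n →₀ ℕ) - toZ (e₀ : Fin n →₀ ℕ))) :
    ∃ Φ : AddMonoidAlgebra κ ↥Q →ₐ[κ] Localization.Away (AddMonoidAlgebra.single e₀ (1 : κ)),
      Function.Injective Φ ∧
      Set.range Φ = (blowupAlgebra (Ideal.span ((fun e : ↥P => AddMonoidAlgebra.single e (1 : κ)) '' E))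
        (AddMonoidAlgebra.single e₀ (1 : κ)) : Set (Localization.Away (AddMonoidAlgebra.single e₀ (1 : κ)))) ∧
      ∀ (q : ↥Q) (p : ↥P) (k : ℕ), ι q + k • toZ (e₀ : Fin n →₀ ℕ) = toZ (p : Fin n →₀ ℕ) →
        Φ (AddMonoidAlgebra.single q 1) * algebraMap _ _ (AddMonoidAlgebra.single e₀ (1 : κ) ^ k) =
          algebraMap _ _ (AddMonoidAlgebra.single p (1 : κ)) := by
  classical
  set y : AddMonoidAlgebra κ ↥P := AddMonoidAlgebra.single e₀ (1 : κ) with hy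
  set J : Ideal (AddMonoidAlgebra κ ↥P) := Ideal.span ((fun e : ↥P => AddMonoidAlgebra.single e (1 : κ)) '' E) with hJ
  obtain ⟨L, Λ, hLinj, hΛinj, hL, hΛL, hΛinv⟩ := exists_algHom_away_laurent κ P e₀
  -- the Laurent monomials
  have hLs : ∀ p : ↥P, Λ (algebraMap _ (Localization.Away y) (AddMonoidAlgebra.single p (1 : κ))) =
      AddMonoidAlgebra.single (toZ (p : Fin n →₀ ℕ)) 1 := fun p => by rw [hΛL, hL]
  have hgen : ∀ e : ↥P, Λ (algebraMap _ (Localization.Away y) (AddMonoidAlgebra.single e (1 : κ)) * IsLocalization.Away.invSelf y) =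
      AddMonoidAlgebra.single (toZ (e : Fin n →₀ ℕ) - toZ (e₀ : Fin n →₀ ℕ)) 1 := fun e => by
    rw [map_mul, hLs, hΛinv, AddMonoidAlgebra.single_mul_single, mul_one, sub_eq_add_neg]
  -- `F q`: the element of the chart ring with Laurent monomial `x^{ι q}`
  have hF : ∀ q : ↥Q, ∃ z : Localization.Away y,
      z ∈ blowupAlgebra J y ∧ Λ z = AddMonoidAlgebra.single (ι q) 1 := by
    intro q
    obtain ⟨p, m, e, heE, hq⟩ := hQ q
    refine ⟨algebraMap _ _ (AddMonoidAlgebra.single p (1 : κ)) *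
      ∏ i, (algebraMap _ (Localization.Away y) (AddMonoidAlgebra.single (e i) (1 : κ)) * IsLocalization.Away.invSelf y), ?_, ?_⟩
    · refine Subalgebra.mul_mem _ (Subalgebra.algebraMap_mem _ _) (Subalgebra.prod_mem _ fun i _ => ?_)
      exact div_mem_blowupAlgebra J y (Ideal.subset_span ⟨e i, heE i, rfl⟩)
    · rw [map_mul, map_prod, hLs]
      simp_rw [hgen]
      rw [AddMonoidAlgebra.prod_single, Finset.prod_const_one, AddMonoidAlgebra.single_mul_single, mul_one, hq]
  choose F hFC hFΛ using hF
  have hF0 : F 0 = 1 := hΛinj (by rw [hFΛ, map_zero, map_one, AddMonoidAlgebra.one_def])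
  have hFadd : ∀ a b, F (a + b) = F a * F b := fun a b =>
    hΛinj (by rw [hFΛ, map_mul, hFΛ, hFΛ, AddMonoidAlgebra.single_mul_single, mul_one, map_add])
  let Fm : Multiplicative ↥Q →* Localization.Away y :=
    { toFun := fun q => F q.toAdd
      map_one' := hF0
      map_mul' := fun a b => hFadd a.toAdd b.toAdd }
  let Φ : AddMonoidAlgebra κ ↥Q →ₐ[κ] Localization.Away y := AddMonoidAlgebra.lift κ (Localization.Away y) ↥Q Fm
  have hΦs : ∀ (q : ↥Q) (c : κ), Φ (AddMonoidAlgebra.single q c) = c • F q := fun q c => by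
    change AddMonoidAlgebra.lift κ (Localization.Away y) ↥Q Fm (AddMonoidAlgebra.single q c) = _
    rw [AddMonoidAlgebra.lift_single]
    rfl
  -- `Λ ∘ Φ` is the Laurent monomial map
  have hΛΦ : ∀ x, Λ (Φ x) = AddMonoidAlgebra.mapDomain ι x := by
    intro x
    induction x using AddMonoidAlgebra.induction_linear with
    | zero => rw [map_zero, map_zero, AddMonoidAlgebra.mapDomain_zero]
    | add f g hf hg => rw [map_add, map_add, hf, hg, AddMonoidAlgebra.mapDomain_add]
    | single q c =>
      rw [hΦs, map_smul, hFΛ, AddMonoidAlgebra.mapDomain_single, AddMonoidAlgebra.smul_single', mul_one]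
  refine ⟨Φ, ?_, ?_, ?_⟩
  · -- injective
    intro a b hab
    have h := congrArg Λ hab
    rw [hΛΦ, hΛΦ] at h
    exact AddMonoidAlgebra.mapDomain_injective hι h
  · -- range = chart ring
    apply Set.Subset.antisymm
    · rintro _ ⟨x, rfl⟩
      induction x using AddMonoidAlgebra.induction_linear with
      | zero => rw [map_zero]; exact Subalgebra.zero_mem _
      | add f g hf hg => rw [map_add]; exact Subalgebra.add_mem _ hf hg
      | single q c =>
        rw [hΦs, Algebra.smul_def]
        refine Subalgebra.mul_mem _ ?_ (hFC q)
        rw [IsScalarTower.algebraMap_apply κ (AddMonoidAlgebra κ ↥P) (Localization.Away y)]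
        exact Subalgebra.algebraMap_mem _ _
    · -- every element of the chart ring is in the range
      -- (i) `κ[P]` lands in the range
      have hA : ∀ a : AddMonoidAlgebra κ ↥P, algebraMap _ (Localization.Away y) a ∈ Set.range Φ := by
        intro a
        induction a using AddMonoidAlgebra.induction_linear with
        | zero => exact ⟨0, by rw [map_zero, map_zero]⟩
        | add f g hf hg =>
          obtain ⟨u, hu⟩ := hf
          obtain ⟨v, hv⟩ := hg
          exact ⟨u + v, by rw [map_add, map_add, hu, hv]⟩
        | single p c =>
          obtain ⟨q, hq⟩ := hP p
          refine ⟨AddMonoidAlgebra.single q c, hΛinj ?_⟩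
          rw [hΛΦ, AddMonoidAlgebra.mapDomain_single, hq, hΛL]
          have : AddMonoidAlgebra.single p c = c • AddMonoidAlgebra.single p (1 : κ) := by
            rw [AddMonoidAlgebra.smul_single', mul_one]
          rw [this, map_smul, hL, AddMonoidAlgebra.smul_single', mul_one]
      -- the range is a subring containing `κ[P]` and the generators `e/e₀`
      have hmulR : ∀ u v : Localization.Away y, u ∈ Set.range Φ → v ∈ Set.range Φ → u * v ∈ Set.range Φ := by
        rintro _ _ ⟨u, rfl⟩ ⟨v, rfl⟩; exact ⟨u * v, map_mul _ _ _⟩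
      have haddR : ∀ u v : Localization.Away y, u ∈ Set.range Φ → v ∈ Set.range Φ → u + v ∈ Set.range Φ := by
        rintro _ _ ⟨u, rfl⟩ ⟨v, rfl⟩; exact ⟨u + v, map_add _ _ _⟩
      have hgenR : ∀ e ∈ E, algebraMap _ (Localization.Away y) (AddMonoidAlgebra.single e (1 : κ)) * IsLocalization.Away.invSelf y ∈
          Set.range Φ := by
        intro e he
        obtain ⟨q, hq⟩ := hE e he
        refine ⟨AddMonoidAlgebra.single q 1, hΛinj ?_⟩
        rw [hΛΦ, AddMonoidAlgebra.mapDomain_single, hq, hgen]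
      -- (ii) `x / e₀` for every `x ∈ J`
      have hJR : ∀ x ∈ J, algebraMap _ (Localization.Away y) x * IsLocalization.Away.invSelf y ∈ Set.range Φ := by
        intro x hx
        induction hx using Submodule.span_induction with
        | mem s hs =>
          obtain ⟨e, he, rfl⟩ := hs
          exact hgenR e he
        | zero => exact ⟨0, by rw [map_zero, map_zero, zero_mul]⟩
        | add u v _ _ hu hv => rw [map_add, add_mul]; exact haddR _ _ hu hv
        | smul a u _ hu =>
          rw [smul_eq_mul, map_mul, mul_assoc]
          exact hmulR _ _ (hA a) hu
      -- (iii) the chart ring is generated by these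
      intro z hz
      change z ∈ blowupAlgebra J y at hz
      unfold blowupAlgebra at hz
      induction hz using Algebra.adjoin_induction with
      | mem s hs =>
        obtain ⟨x, hx, rfl⟩ := hs
        exact hJR x hx
      | algebraMap a => exact hA a
      | add u v _ _ hu hv => exact haddR _ _ hu hv
      | mul u v _ _ hu hv => exact hmulR _ _ hu hv
  · -- the characterization
    intro q p k hk
    apply hΛinj
    have h1 : Λ (algebraMap _ (Localization.Away y) (y ^ k)) = AddMonoidAlgebra.single (k • toZ (e₀ : Fin n →₀ ℕ)) (1 : κ) := by
      rw [hΛL, map_pow, hL, AddMonoidAlgebra.single_pow, one_pow]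
    rw [map_mul, hΦs, one_smul, hFΛ, h1, AddMonoidAlgebra.single_mul_single, mul_one, hk, hLs]

end Summit.ResolutionOfSingularities.ResolutionOfSingularities.Theorems.FRationalResolution.MonoidAlgebraLaurent

end
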